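import Literature.Analysis.FunctionSpaces.TorusAxisAverageCalculus
import Summits.NavierStokesRegularity.FunctionalMining.BiaxialContact
import Summits.NavierStokesRegularity.FunctionalMining.TopEigHeatDanskin
import Summits.NavierStokesRegularity.FunctionalMining.TopEigHeatCoerciveGap
import HarnessLib

/-!
# FunctionalMining / NoGo — K55: LINE SPREAD for (F2) witnesses on `T³`
# on EVERY closed coordinate line `L`: `∫_L Sᵢᵢ = 0`, `∫_L (λ₁ − Sᵢᵢ) = ∫_L λ₁`,
# `(3 − ε) · ∫_{L ∩ ε-aligned} λ₁ ≤ 2 ∫_L λ₁`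

HONEST FRAMING. Search for candidate a priori estimates; no regularity claim. Nothing about
Navier–Stokes is proved or asserted in this file. Cell `pub-nsfunc`, no-go seat (gen 51, touch 5).
Static calculus of smooth fields on the flat torus (no heat flow enters): constraints on the SHAPE
of a killing family for door (b)/(F2) of `NOGO.md`, LINE BY LINE — the one-dimensional
sharpening of K54 (FRAME SPREAD, `∫_{T³} eᵀSe = 0`).

CONTEXT. (F2) is the WANTED kernel negation `¬ TopEigHeatCoercivePos q` of the open node Lemma
L-λ(q): a KILLING FAMILY `v_n` with `heatDissipation Φ_q v_n / Φ_q v_n → 0`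
(`Φ_q = torusTopEigMoment q = ∫ (λ₁⁺)^q`, `λ₁ = torusStrainTopEig v`). The recorded design rules
make a killing family FLAT (`λ₁ ≈ m`, (R12)), TORUS-FILLING ((R12′)), ISO-TOP-like ((R11)) and
FRAME-SPREAD ((R13), K54: for every fixed axis `e` the `ε`-aligned set carries at most
`2/(3 − ε)` of the top-strain mass of the WHOLE torus). This file localises (R13) to single closed
lines: the diagonal strain entry `Sᵢᵢ = ∂ᵢvᵢ` is the derivative ALONG the line of the periodic
function `vᵢ`, so it has zero mean on EVERY closed `xᵢ`-line, not only on the torus.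

CONTENT (`axisAvg i f x = ∫ f (x + s eᵢ) ds` over `s : UnitAddCircle`, Literature
`TorusAxisAverage(Calculus)`; `v` smooth on `T^d`, then on `T³ = UnitAddTorus (Fin 3)`).
§ 1 (any `d`, any target space) **`axisAvg_partialDeriv_self`** `axisAvg i (∂ᵢ f) = 0`: the axis
average is invariant under the axis translations, so its own `∂ᵢ` vanishes, and `∂ᵢ` commutes
with `axisAvg i` (Literature `Torus.partialDeriv_axisAvg`).
§ 2 (any `d`) ZERO LINE MEAN OF THE DIAGONAL STRAIN: `Sᵢᵢ(x) = ∂ᵢvᵢ(x)` and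
**`lineIntegral_strainDiag_eq_zero`** `∫ Sᵢᵢ (x + s eᵢ) ds = 0` for EVERY base point `x`.
§ 3 (`T³`, divergence free) pointwise `−2λ₁ ≤ Sᵢᵢ ≤ λ₁` (Rayleigh at `e = eᵢ`, tree
`BiaxialEikonal.quadStrain_le_top` / `neg_two_mul_top_le_quadStrain`) and LINE MISALIGNMENT = LINE
MASS **`lineIntegral_topEig_sub_strainDiag_eq`** `∫ (λ₁ − Sᵢᵢ)(x + s eᵢ) ds = ∫ λ₁ (x + s eᵢ) ds`.
§ 4 LINE SPREAD: with the line-aligned set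
`lineAlignedSet v i ε x = {s | (1 − ε) λ₁ ≤ Sᵢᵢ at x + s eᵢ}`, **`line_spread`**
`(3 − ε) · ∫_{lineAlignedSet} λ₁(x + s eᵢ) ds ≤ 2 · ∫ λ₁(x + s eᵢ) ds` and **`line_spread_compl`**
`(1 − ε) · ∫ λ₁ ≤ (3 − ε) · ∫_{lineAlignedSetᶜ} λ₁` on every closed `xᵢ`-line; the plateau reading
**`line_plateau_aligned_measureReal_le`**.
§ 5 NO ALIGNED FIBRE **`topEig_eq_zero_on_aligned_line`**: if along ONE closed `xᵢ`-line the axis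
`eᵢ` is everywhere `ε`-aligned with the top eigen-direction (`(1 − ε) λ₁ ≤ Sᵢᵢ`, some `ε < 1`),
then `λ₁ = 0` — hence the whole strain vanishes (**`strainFlat_eq_zero_on_aligned_line`**) — at
every point of that line.

MEANING FOR (F2) (design rule (R13⁺), records only). LINE SPREAD: along a killing family
(`λ₁ ≈ m` on an asymptotically full plateau) EVERY closed coordinate line spends at least the
fraction `(1 − ε)/(3 − ε) − o(1)` of its `λ₁`-mass tilted against its own direction by a Rayleigh
defect `≥ ε λ₁`, and no closed coordinate line can be an ALIGNED FIBRE (top direction along the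
line on the whole line): columnar / fibred textures — e.g. a fan of wells around an axis
parallel to `e₃`, whose core has top direction `e₃` all along the axis — are dead unless they are
interrupted along the axis by material of the opposite sign (`S₃₃ < 0`), line by line. K54's torus
statements are the averages of these line statements over the base point. CALIBRATION (records):
the circularly polarised laminate `(sin 2πx₃, cos 2πx₃, 0)` (`λ₁ ≡ π`, every diagonal strain entry
`≡ 0`) passes every line rule here — its line-aligned sets are EMPTY for `ε < 1` — and is
nevertheless heat-priced (`heatDissipation Φ₂ ≥ 8π² Φ₂`, laminate rigidity, tree
`TopEigLaminate.laminate_rigid_two_V'`): like (R11)–(R13), the rule (R13⁺) CONSTRAINS a killing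
family, it does not select one. Nothing here bounds `heatDissipation`, so (F2) stays WANTED/OPEN and
L-λ(q) OPEN for every real `q > 1`.
[ours = assembly; folklore = `∫_{S¹} g' = 0`, Rayleigh bounds]
FILING (prove seat g29, REQUEST #83): declarations byte-identical to the no-go seat's staged `TopEigLineSpread.STAGING.lean` 81b114691d48764b; this line is the only addition.
-/

noncomputable section

open MeasureTheory Set Filter Topology

namespace Summit.NavierStokesRegularity.FunctionalMining
open Literature.Analysis Literature.Analysis.FunctionSpaces Literature.Analysis.FunctionSpaces.Torus
  Literature.Analysis.FluidPDE TopEig BiaxialEikonal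

namespace TopEig

namespace LineSpread

/-! ## 1. The axis average kills its own partial derivative -/

section General

variable {d : Type*} [Fintype d] [DecidableEq d]
variable {F : Type*} [NormedAddCommGroup F] [NormedSpace ℝ F]

omit [Fintype d] in
/-- A function invariant under the `i`-th axis translations has `∂ᵢ = 0` (the coordinate line
`t ↦ x + proj (t eᵢ) = x + (t mod 1) eᵢ` stays in the orbit). [folklore] -/
theorem partialDeriv_eq_zero_of_forall_add_single {g : UnitAddTorus d → F} {i : d}
    (hg : ∀ (s : UnitAddCircle) (x : UnitAddTorus d), g (x + Pi.single i s) = g x)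
    (x : UnitAddTorus d) : Torus.partialDeriv i g x = 0 := by
  show deriv (fun t : ℝ => g (x + Torus.proj (t • EuclideanSpace.single i (1 : ℝ)))) 0 = 0
  have h : (fun t : ℝ => g (x + Torus.proj (t • EuclideanSpace.single i (1 : ℝ)))) =
      fun _ => g x := by
    funext t
    rw [Torus.proj_smul_single, hg]
  rw [h, deriv_const]

/-- **`axisAvg i (∂ᵢ f) = 0`** for a smooth `f : T^d → F`: `∂ᵢ (axisAvg i f) = axisAvg i (∂ᵢ f)`
(Literature) and the left side vanishes by translation invariance of the axis average. In words:
`∫ (∂ᵢ f)(x + s eᵢ) ds = 0` on every closed `xᵢ`-line. [folklore] -/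
theorem axisAvg_partialDeriv_self [CompleteSpace F] {f : UnitAddTorus d → F} (hf : Torus.IsSmooth f)
    (i : d) : Torus.axisAvg i (Torus.partialDeriv i f) = 0 := by
  rw [← Torus.partialDeriv_axisAvg hf i i]
  funext x
  rw [Pi.zero_apply]
  exact partialDeriv_eq_zero_of_forall_add_single (fun s y => Torus.axisAvg_add_single i f s y) x

/-- Integral form: `∫ (∂ᵢ f)(x + s eᵢ) ds = 0` for every base point `x`. [folklore] -/
theorem lineIntegral_partialDeriv_self_eq_zero [CompleteSpace F] {f : UnitAddTorus d → F}
    (hf : Torus.IsSmooth f) (i : d) (x : UnitAddTorus d) :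
    ∫ s : UnitAddCircle, Torus.partialDeriv i f (x + Pi.single i s) = 0 := by
  have h := congrFun (axisAvg_partialDeriv_self hf i) x
  rwa [Torus.axisAvg_apply] at h

/-! ## 2. Zero line mean of the diagonal strain -/

/-- `Sᵢᵢ(x) = ∂ᵢ vᵢ (x)`. [folklore] -/
theorem torusStrainMatrix_diag (v : UnitAddTorus d → EuclideanSpace ℝ d) (x : UnitAddTorus d)
    (i : d) :
    torusStrainMatrix v x i i = Torus.partialDeriv i v x i := by
  simp only [torusStrainMatrix, Matrix.of_apply]
  ring

/-- **ZERO LINE MEAN.** For a smooth field `v` on `T^d`, every axis `i` and EVERY base point `x`: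
`∫ Sᵢᵢ (x + s eᵢ) ds = 0` — the diagonal strain entry is the derivative along the line of the
periodic function `vᵢ`. [ours, bookkeeping; folklore] -/
theorem lineIntegral_strainDiag_eq_zero {v : UnitAddTorus d → EuclideanSpace ℝ d}
    (hv : Torus.IsSmooth v) (i : d) (x : UnitAddTorus d) :
    ∫ s : UnitAddCircle, torusStrainMatrix v (x + Pi.single i s) i i = 0 := by
  simp only [torusStrainMatrix_diag]
  have h1 : Torus.axisAvg i (fun y => Torus.partialDeriv i v y i) x = 0 := by
    rw [← Torus.axisAvg_apply_coord (hv.partialDeriv i).continuous i i x,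
      congrFun (axisAvg_partialDeriv_self hv i) x]
    simp
  rwa [Torus.axisAvg_apply] at h1

end General

/-! ## 3. Line misalignment = line mass (`T³`, divergence free) -/

variable {v : UnitAddTorus (Fin 3) → EuclideanSpace ℝ (Fin 3)}

/-- The Rayleigh sum at the axis vector `eᵢ` is the diagonal entry `Sᵢᵢ`. [folklore] -/
theorem quadStrain_single (v : UnitAddTorus (Fin 3) → EuclideanSpace ℝ (Fin 3))
    (x : UnitAddTorus (Fin 3)) (i : Fin 3) :
    ∑ j, ∑ k, (Pi.single i (1 : ℝ) : Fin 3 → ℝ) j * torusStrainMatrix v x j k *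
        (Pi.single i (1 : ℝ) : Fin 3 → ℝ) k = torusStrainMatrix v x i i := by
  simp [Pi.single_apply]

/-- `Sᵢᵢ(x) ≤ λ₁(x)` (Rayleigh). [folklore] -/
theorem strainDiag_le_top (v : UnitAddTorus (Fin 3) → EuclideanSpace ℝ (Fin 3))
    (x : UnitAddTorus (Fin 3)) (i : Fin 3) : torusStrainMatrix v x i i ≤ torusStrainTopEig v x := by
  have h := quadStrain_le_top v x (e := Pi.single i (1 : ℝ)) (by simp)
  rwa [quadStrain_single] at h

/-- `−2 λ₁(x) ≤ Sᵢᵢ(x)` on a divergence-free field (`Sᵢᵢ ≥ λ₃ ≥ −2λ₁`). [folklore] -/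
theorem neg_two_mul_top_le_strainDiag (hv : Torus.IsSmooth v) (hdiv : Torus.IsDivFree v)
    (x : UnitAddTorus (Fin 3)) (i : Fin 3) :
    -2 * torusStrainTopEig v x ≤ torusStrainMatrix v x i i := by
  have h := neg_two_mul_top_le_quadStrain (d := Fin 3) (by simp) hv hdiv x
    (e := Pi.single i (1 : ℝ)) (by simp)
  rwa [quadStrain_single] at h

/-- Continuity of `λ₁` along a coordinate line. [folklore] -/
theorem continuous_topEig_line (hv : Torus.IsSmooth v) (i : Fin 3) (x : UnitAddTorus (Fin 3)) :
    Continuous fun s : UnitAddCircle => torusStrainTopEig v (x + Pi.single i s) :=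
  (continuous_torusStrainTopEig hv).comp
    (continuous_const.add (continuous_single (A := fun _ : Fin 3 => UnitAddCircle) i))

/-- Continuity of `Sᵢᵢ` along a coordinate line. [folklore] -/
theorem continuous_strainDiag_line (hv : Torus.IsSmooth v) (i : Fin 3) (x : UnitAddTorus (Fin 3)) :
    Continuous fun s : UnitAddCircle => torusStrainMatrix v (x + Pi.single i s) i i := by
  simp only [torusStrainMatrix_diag]
  exact ((hv.partialDeriv i).apply i).continuous.comp
    (continuous_const.add (continuous_single (A := fun _ : Fin 3 => UnitAddCircle) i))

/-- Integrability of `λ₁` along a coordinate line (continuous on the compact circle). [folklore] -/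
theorem integrable_topEig_line (hv : Torus.IsSmooth v) (i : Fin 3) (x : UnitAddTorus (Fin 3)) :
    Integrable (fun s : UnitAddCircle => torusStrainTopEig v (x + Pi.single i s)) :=
  (continuous_topEig_line hv i x).integrable_of_hasCompactSupport
    (HasCompactSupport.of_compactSpace _)

/-- Integrability of `Sᵢᵢ` along a coordinate line. [folklore] -/
theorem integrable_strainDiag_line (hv : Torus.IsSmooth v) (i : Fin 3) (x : UnitAddTorus (Fin 3)) :
    Integrable (fun s : UnitAddCircle => torusStrainMatrix v (x + Pi.single i s) i i) :=
  (continuous_strainDiag_line hv i x).integrable_of_hasCompactSupport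
    (HasCompactSupport.of_compactSpace _)

/-- **LINE MISALIGNMENT = LINE MASS.** `∫ (λ₁ − Sᵢᵢ)(x + s eᵢ) ds = ∫ λ₁(x + s eᵢ) ds` on every
closed `xᵢ`-line, with the pointwise sandwich `0 ≤ λ₁ − Sᵢᵢ ≤ 3λ₁` (divergence free): the
`λ₁`-weighted line average of the normalised Rayleigh defect of the axis, `(λ₁ − Sᵢᵢ)/λ₁ ∈ [0, 3]`,
is exactly `1` on EVERY line. [ours] -/
theorem lineIntegral_topEig_sub_strainDiag_eq (hv : Torus.IsSmooth v) (i : Fin 3)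
    (x : UnitAddTorus (Fin 3)) :
    ∫ s : UnitAddCircle, (torusStrainTopEig v (x + Pi.single i s) -
        torusStrainMatrix v (x + Pi.single i s) i i) =
      ∫ s : UnitAddCircle, torusStrainTopEig v (x + Pi.single i s) := by
  rw [integral_sub (integrable_topEig_line hv i x) (integrable_strainDiag_line hv i x),
    lineIntegral_strainDiag_eq_zero hv i x, sub_zero]

/-! ## 4. Line spread -/

/-- The LINE-ALIGNED SET of the axis `i` through the base point `x`: the parameters `s` of the
closed `xᵢ`-line at which the Rayleigh defect of `eᵢ` is at most `ε λ₁`,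
`(1 − ε) λ₁(x + s eᵢ) ≤ Sᵢᵢ(x + s eᵢ)` (`ε = 0`: `eᵢ` is a top eigenvector there). [ours] -/
def lineAlignedSet (v : UnitAddTorus (Fin 3) → EuclideanSpace ℝ (Fin 3)) (i : Fin 3) (ε : ℝ)
    (x : UnitAddTorus (Fin 3)) : Set UnitAddCircle :=
  {s | (1 - ε) * torusStrainTopEig v (x + Pi.single i s) ≤
    torusStrainMatrix v (x + Pi.single i s) i i}

/-- The line-aligned set is measurable (closed). [ours, bookkeeping] -/
theorem measurableSet_lineAlignedSet (hv : Torus.IsSmooth v) (i : Fin 3) (ε : ℝ)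
    (x : UnitAddTorus (Fin 3)) : MeasurableSet (lineAlignedSet v i ε x) :=
  measurableSet_le (continuous_const.mul (continuous_topEig_line hv i x)).measurable
    (continuous_strainDiag_line hv i x).measurable

/-- **LINE SPREAD.** For a smooth divergence-free `v` on `T³`, an axis `i`, any real `ε` and EVERY
base point `x`: `(3 − ε) · ∫_{lineAlignedSet} λ₁(x + s eᵢ) ds ≤ 2 · ∫ λ₁(x + s eᵢ) ds`. Proof:
`0 = ∫_L Sᵢᵢ = ∫_A + ∫_{Aᶜ}` with `Sᵢᵢ ≥ (1 − ε)λ₁` on `A` and `Sᵢᵢ ≥ −2λ₁` on `Aᶜ`. [ours] -/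
theorem line_spread (hv : Torus.IsSmooth v) (hdiv : Torus.IsDivFree v) (i : Fin 3) (ε : ℝ)
    (x : UnitAddTorus (Fin 3)) :
    (3 - ε) * ∫ s in lineAlignedSet v i ε x, torusStrainTopEig v (x + Pi.single i s) ≤
      2 * ∫ s : UnitAddCircle, torusStrainTopEig v (x + Pi.single i s) := by
  have hAm := measurableSet_lineAlignedSet hv i ε x
  have hQi := integrable_strainDiag_line hv i x
  have hLi := integrable_topEig_line hv i x
  have h0 := lineIntegral_strainDiag_eq_zero hv i x
  have hsplit := integral_add_compl hAm hQi
  have hLsplit := integral_add_compl hAm hLi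
  have hA : ∫ s in lineAlignedSet v i ε x, (1 - ε) * torusStrainTopEig v (x + Pi.single i s) ≤
      ∫ s in lineAlignedSet v i ε x, torusStrainMatrix v (x + Pi.single i s) i i :=
    setIntegral_mono_on (hLi.const_mul _).integrableOn hQi.integrableOn hAm fun s hs => hs
  have hAc : ∫ s in (lineAlignedSet v i ε x)ᶜ, -2 * torusStrainTopEig v (x + Pi.single i s) ≤
      ∫ s in (lineAlignedSet v i ε x)ᶜ, torusStrainMatrix v (x + Pi.single i s) i i :=
    setIntegral_mono_on (hLi.const_mul _).integrableOn hQi.integrableOn hAm.compl fun s _ =>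
      neg_two_mul_top_le_strainDiag hv hdiv _ i
  rw [integral_const_mul] at hA hAc
  have key : (3 - ε) * ∫ s in lineAlignedSet v i ε x, torusStrainTopEig v (x + Pi.single i s) =
      (1 - ε) * (∫ s in lineAlignedSet v i ε x, torusStrainTopEig v (x + Pi.single i s)) +
        2 * ∫ s in lineAlignedSet v i ε x, torusStrainTopEig v (x + Pi.single i s) := by ring
  rw [key]
  linarith

/-- Ratio form (`ε < 3`): `∫_{lineAlignedSet} λ₁ ≤ 2/(3 − ε) · ∫_L λ₁`. [ours] -/
theorem lineSetIntegral_aligned_le (hv : Torus.IsSmooth v) (hdiv : Torus.IsDivFree v) (i : Fin 3)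
    {ε : ℝ} (hε : ε < 3) (x : UnitAddTorus (Fin 3)) :
    ∫ s in lineAlignedSet v i ε x, torusStrainTopEig v (x + Pi.single i s) ≤
      2 / (3 - ε) * ∫ s : UnitAddCircle, torusStrainTopEig v (x + Pi.single i s) := by
  rw [show 2 / (3 - ε) * ∫ s : UnitAddCircle, torusStrainTopEig v (x + Pi.single i s) =
      (2 * ∫ s : UnitAddCircle, torusStrainTopEig v (x + Pi.single i s)) / (3 - ε) by ring,
    le_div_iff₀ (sub_pos.mpr hε), mul_comm]
  exact line_spread hv hdiv i ε x

/-- **LINE SPREAD, complement form.** `(1 − ε) · ∫_L λ₁ ≤ (3 − ε) · ∫_{L ∖ lineAlignedSet} λ₁`: on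
every closed coordinate line at least the fraction `(1 − ε)/(3 − ε)` of the line's top-strain mass
sits where the axis is tilted against the top frame by a defect `> ε λ₁`. [ours] -/
theorem line_spread_compl (hv : Torus.IsSmooth v) (hdiv : Torus.IsDivFree v) (i : Fin 3) (ε : ℝ)
    (x : UnitAddTorus (Fin 3)) :
    (1 - ε) * ∫ s : UnitAddCircle, torusStrainTopEig v (x + Pi.single i s) ≤
      (3 - ε) * ∫ s in (lineAlignedSet v i ε x)ᶜ, torusStrainTopEig v (x + Pi.single i s) := by
  have hAm := measurableSet_lineAlignedSet hv i ε x
  have hLi := integrable_topEig_line hv i x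
  have h := line_spread hv hdiv i ε x
  have hLsplit := integral_add_compl hAm hLi
  have hb : ∫ s in (lineAlignedSet v i ε x)ᶜ, torusStrainTopEig v (x + Pi.single i s) =
      (∫ s : UnitAddCircle, torusStrainTopEig v (x + Pi.single i s)) -
        ∫ s in lineAlignedSet v i ε x, torusStrainTopEig v (x + Pi.single i s) := by linarith
  rw [hb]
  nlinarith

/-- **LINE PLATEAU READING.** If `m ≤ λ₁` on a measurable set `B` of parameters of the line and
`ε ≤ 3`, then `(3 − ε) · m · |lineAlignedSet ∩ B| ≤ 2 · ∫_L λ₁`: on a flat line (`λ₁ ≈ m`,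
`∫_L λ₁ ≈ m`) the axis-aligned portion has length at most `2/(3 − ε)`. [ours] -/
theorem line_plateau_aligned_measureReal_le (hv : Torus.IsSmooth v) (hdiv : Torus.IsDivFree v)
    (i : Fin 3) {ε : ℝ} (hε : ε ≤ 3) (x : UnitAddTorus (Fin 3)) {B : Set UnitAddCircle}
    (hB : MeasurableSet B) {m : ℝ} (hm : ∀ s ∈ B, m ≤ torusStrainTopEig v (x + Pi.single i s)) :
    (3 - ε) * (m * volume.real (lineAlignedSet v i ε x ∩ B)) ≤
      2 * ∫ s : UnitAddCircle, torusStrainTopEig v (x + Pi.single i s) := by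
  have hAm := measurableSet_lineAlignedSet hv i ε x
  have hLi := integrable_topEig_line hv i x
  have h1 : m * volume.real (lineAlignedSet v i ε x ∩ B) ≤
      ∫ s in lineAlignedSet v i ε x ∩ B, torusStrainTopEig v (x + Pi.single i s) := by
    have hc : ∫ s in lineAlignedSet v i ε x ∩ B, m =
        m * volume.real (lineAlignedSet v i ε x ∩ B) := by
      rw [setIntegral_const, smul_eq_mul, mul_comm]
    rw [← hc]
    exact setIntegral_mono_on (integrable_const m).integrableOn hLi.integrableOn (hAm.inter hB)
      fun s hs => hm s hs.2
  have h2 : ∫ s in lineAlignedSet v i ε x ∩ B, torusStrainTopEig v (x + Pi.single i s) ≤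
      ∫ s in lineAlignedSet v i ε x, torusStrainTopEig v (x + Pi.single i s) :=
    setIntegral_mono_set hLi.integrableOn
      (ae_of_all _ fun s => torusStrainTopEig_nonneg (d := Fin 3) (by simp) hv hdiv _)
      (ae_of_all _ inter_subset_left)
  have h3 := line_spread hv hdiv i ε x
  have h3e : 0 ≤ 3 - ε := sub_nonneg.mpr hε
  nlinarith [mul_le_mul_of_nonneg_left (h1.trans h2) h3e]

/-! ## 5. No aligned fibre -/

/-- If along the whole closed `xᵢ`-line through `x` the axis is `ε`-aligned with the top frame for
some `ε < 1`, then `∫_L λ₁ = 0`. [ours] -/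
theorem lineIntegral_topEig_eq_zero_of_aligned (hv : Torus.IsSmooth v) (hdiv : Torus.IsDivFree v)
    {i : Fin 3} {ε : ℝ} (hε : ε < 1) {x : UnitAddTorus (Fin 3)}
    (h : ∀ s : UnitAddCircle, (1 - ε) * torusStrainTopEig v (x + Pi.single i s) ≤
      torusStrainMatrix v (x + Pi.single i s) i i) :
    ∫ s : UnitAddCircle, torusStrainTopEig v (x + Pi.single i s) = 0 := by
  have hset : lineAlignedSet v i ε x = univ := eq_univ_of_forall fun s => h s
  have hsp := line_spread hv hdiv i ε x
  rw [hset, setIntegral_univ] at hsp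
  have hnn : 0 ≤ ∫ s : UnitAddCircle, torusStrainTopEig v (x + Pi.single i s) :=
    integral_nonneg fun s => torusStrainTopEig_nonneg (d := Fin 3) (by simp) hv hdiv _
  nlinarith

/-- **NO ALIGNED FIBRE.** If along the whole closed `xᵢ`-line through `x` the axis `eᵢ` is
`ε`-aligned with the top eigen-direction for some `ε < 1`, then `λ₁ = 0` at EVERY point of that
line (a continuous non-negative function with zero integral on the circle). [ours] -/
theorem topEig_eq_zero_on_aligned_line (hv : Torus.IsSmooth v) (hdiv : Torus.IsDivFree v)
    {i : Fin 3} {ε : ℝ} (hε : ε < 1) {x : UnitAddTorus (Fin 3)}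
    (h : ∀ s : UnitAddCircle, (1 - ε) * torusStrainTopEig v (x + Pi.single i s) ≤
      torusStrainMatrix v (x + Pi.single i s) i i) (s : UnitAddCircle) :
    torusStrainTopEig v (x + Pi.single i s) = 0 := by
  have hint := lineIntegral_topEig_eq_zero_of_aligned hv hdiv hε h
  have hnn : 0 ≤ fun t : UnitAddCircle => torusStrainTopEig v (x + Pi.single i t) :=
    fun t => torusStrainTopEig_nonneg (d := Fin 3) (by simp) hv hdiv _
  have hae := (integral_eq_zero_iff_of_nonneg hnn (integrable_topEig_line hv i x)).1 hint
  have hfun := ((continuous_topEig_line hv i x).ae_eq_iff_eq volume continuous_const).1 hae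
  exact congrFun hfun s

/-- Contrapositive, the form used as a design rule: if `λ₁ > 0` somewhere on a closed `xᵢ`-line,
then for every `ε < 1` the axis `eᵢ` is tilted against the top frame by a Rayleigh defect
`> ε λ₁` somewhere on that line. [ours] -/
theorem exists_misaligned_on_line (hv : Torus.IsSmooth v) (hdiv : Torus.IsDivFree v) (i : Fin 3)
    {ε : ℝ} (hε : ε < 1) {x : UnitAddTorus (Fin 3)}
    (hpos : ∃ s : UnitAddCircle, 0 < torusStrainTopEig v (x + Pi.single i s)) :
    ∃ s : UnitAddCircle, torusStrainMatrix v (x + Pi.single i s) i i <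
      (1 - ε) * torusStrainTopEig v (x + Pi.single i s) := by
  by_contra hcon
  simp only [not_exists, not_lt] at hcon
  obtain ⟨s, hs⟩ := hpos
  have h0 := topEig_eq_zero_on_aligned_line hv hdiv hε hcon s
  linarith

/-- … and then the whole strain vanishes along that line (`‖S‖ ≤ 6 λ₁` for symmetric trace-free
tensors, tree `TopEig.norm_strainFlat_le`): an aligned fibre carries NO strain at all. [ours] -/
theorem strainFlat_eq_zero_on_aligned_line (hv : Torus.IsSmooth v) (hdiv : Torus.IsDivFree v)
    {i : Fin 3} {ε : ℝ} (hε : ε < 1) {x : UnitAddTorus (Fin 3)}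
    (h : ∀ s : UnitAddCircle, (1 - ε) * torusStrainTopEig v (x + Pi.single i s) ≤
      torusStrainMatrix v (x + Pi.single i s) i i) (s : UnitAddCircle) :
    StrainL4.strainFlat v (x + Pi.single i s) = 0 := by
  have hlam : lam (StrainL4.strainFlat v (x + Pi.single i s)) = 0 := by
    rw [lam_strainFlat]
    exact topEig_eq_zero_on_aligned_line hv hdiv hε h s
  have hn := norm_strainFlat_le hv hdiv (x + Pi.single i s)
  rw [hlam, mul_zero] at hn
  exact norm_le_zero_iff.1 hn

end LineSpread

end TopEig

end Summit.NavierStokesRegularity.FunctionalMining
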